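import Literature.AlgebraicGeometry.ShimuraVarieties.UnitaryShimuraCurveRecord
import Mathlib.NumberTheory.NumberField.InfinitePlace.Basic
import Mathlib.FieldTheory.IsAlgClosed.Basic
import Mathlib.Algebra.Module.Torsion.Field
import HarnessLib

/-!
# The signature of the Gram matrix of a unitary Shimura-curve record, read off its pieces

Topic `Literature/AlgebraicGeometry/ShimuraVarieties`, namespace
`Literature.AlgebraicGeometry.ShimuraVarieties.UnitaryCanonicalModel`.  Cell `hodgecm-mathlib`, FLOOR 0, crux item
stmt-HodgeConjecture-24832 (HLiu418), E-line `Cruxes/HLiu418/Lines/F0_P6a_PELWitnessE.lean` ED. 4, socket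
`stub_SIG : RecordSignatureDatumOfSystem` (LEAD heir F0P6-plan (g3) «M-42» (a); SIG-AUDIT verdict of record F0P6-ref1 (g3) ∕
F0P5a-ref1 (g8), 2026-09-01).  THEOREMS ONLY (no definition, no named fact, no instance, no `sorry`).

THE PRINT.  [Liu2021] App. C §C.1 p. 107 and Rem. C.2 p. 108: the hermitian space of the unitary Shimura variety has
signature `(n − 1, 1)` at `τ` and `(n, 0)` at the other places (here `n = 2`); [RapoportSmithlingZhang2020Diagonal] §3.1 p. 8.
[Deligne1979ShimuraVarieties] 2.1.2 ∕ [Milne2005ShimuraVarieties] Lemma 5.13 p. 57: `Sh_K(ℂ)` is the disjoint sum over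
`G(ℚ)\G(𝔸_f)/K` of arithmetic quotients `Γ_g \ X⁺`.  In the tree the rank-2 record ★ `UnitaryCanonicalModel.RecordSystemGS`
carries the dissection as clause (F2c) `pieces`: every piece is a compact ball quotient of the tree's kind
(★ `UnitaryBallUniformisationDatum 1 (X q)`) whose COMPLEX Gram matrix is `(B q).Hℂ = J⋆^τ` — and every ball datum has, for ITS
OWN CM field `E ⊆ ℂ` and Gram matrix `H ∈ M₂(E)`, the fields `signature_τ₁` (signature `(1,1)` at the inclusion `E ⊆ ℂ`) and
`posDef_of_ne` (positive definite at every complex embedding of `E` off the place of the inclusion).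

WHAT IS PROVED (the in-house half of `stub_SIG`, SIG-AUDIT cases (1,1)-at-`ι₁` and (2)).  For a record
`S : RecordSystemGS L J⋆ τ K₀` and any small level `Kc`:
* `RecordSystemGS.exists_ballDatum_Hℂ_eq` — (F2c) at the unit double coset: a piece datum `D` with `D.Hℂ = J⋆^τ`.
* `RecordSystemGS.exists_conjTranspose_mul_map_mul_eq_signatureMatrix_one` — `J⋆^τ` has signature `(1,1)`:
  `∃ T : GL₂(ℂ), Tᴴ · J⋆^τ · T = diag(1, −1)` (= `D.signature_τ₁` transported along `D.Hℂ = J⋆^τ`).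
* `RecordSystemGS.posDef_map_of_ne` — OFF-PLACE POSITIVITY IN CASE (2): for a complex embedding `σ` of `L` whose
  entrywise action on `J⋆` differs from that of `τ` AND from that of `τ̄` (`J⋆^σ ≠ J⋆^τ`, `J⋆^σ ≠ J⋆^τ̄` — i.e. `σ` and `τ`, `τ̄`
  differ on `L₁ := ℚ(J⋆ᵢⱼ)`), the matrix `J⋆^σ` is POSITIVE DEFINITE.  Proof: `τ(L₁) ⊆ E` because the entries of `J⋆^τ = D.Hℂ`
  lie in `E`; the embedding `σ ∘ τ⁻¹ : τ(L₁) → ℂ` extends to `τ′ : E →+* ℂ` (`IsAlgClosed.lift`, `E` a number field); `τ′` is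
  off the place of the inclusion (`NumberField.InfinitePlace.mk_eq_iff`: else `τ′ ∈ {incl, conj ∘ incl}`, forcing `J⋆^σ = J⋆^τ`
  or `J⋆^σ = J⋆^τ̄`); `D.posDef_of_ne τ′` and `D.H^{τ′} = J⋆^σ` entrywise.
* `RecordSystemGS.signature_and_posDef_of_forall_ne` — the assembled signature conjuncts under the case-(3)-emptiness
  hypothesis «every `σ` off the place of `τ` moves `J⋆` off `{J⋆^τ, J⋆^τ̄}`» (SIG-AUDIT criterion: automatic when
  `ℚ(J⋆ᵢⱼ) ⊇ L⁺`): `∃ T, Tᴴ J⋆^τ T = diag(1,−1)` and `∀ σ, mk σ ≠ mk τ → (J⋆^σ).PosDef`;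
  `RecordSystemGS.exists_sigDatum_one_of_forall_ne` — the same packaged as the E-line's `SigDatum L τ J⋆` body (unfolded,
  token for token) with the trivial rescaling `t = 1`.
NOT PROVED HERE (the honest residue of `stub_SIG`, «NOREC», SIG-AUDIT case (3)): when some `σ` off the place of `τ` has
`J⋆^σ ∈ {J⋆^τ, J⋆^τ̄}` no record exists (irreducible-lattice non-discreteness, [Margulis1991] Ch. II Thm. (6.7)(a)) — XL, not in
the tree.  HC_CM is proved only modulo the printed citations until rung 0 closes; this file discharges no named fact.
-/

set_option autoImplicit false

noncomputable section

open Function MulAction NumberField Matrix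
open scoped Matrix ComplexOrder
open Literature.AlgebraicGeometry.Motives (SchemeOver)
open Literature.NumberTheory.Automorphic Literature.NumberTheory.Automorphic.UnitaryGroup
open Literature.NumberTheory.Automorphic.ShimuraDissection
open Literature.NumberTheory.Automorphic.Liu2021.AppendixC (C5.OpenCompactSubgroup C5.SmallLevel)

namespace Literature.AlgebraicGeometry.ShimuraVarieties

namespace UnitaryCanonicalModel

variable {L : Type} [Field L] [NumberField L] [IsCMField L] {Jstar : Matrix (Fin 2) (Fin 2) L} {τ : L →+* ℂ}
variable {K₀ : C5.OpenCompactSubgroup ↥(finAdelic (↥(maximalRealSubfield L)) L (IsCMField.complexConj L) 2 Jstar)}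

/-- **(F2c) at the unit double coset**: a record hands, at every small level, a ball-uniformisation datum of the tree's
kind whose complex Gram matrix is `J⋆^τ` (the piece of `⟦1 · Kc⟧`; [Deligne1979ShimuraVarieties] 2.1.2 «a disjoint sum,
indexed by `G(ℚ)\G(𝔸^f)/K`, of the quotients `Γ_g\X⁺`»).
[cite: Deligne1979ShimuraVarieties, 2.1.2] [cite: Milne2005ShimuraVarieties, Lemma 5.13 p. 57] -/
theorem RecordSystemGS.exists_ballDatum_Hℂ_eq (S : RecordSystemGS L Jstar τ K₀) (Kc : C5.SmallLevel K₀) :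
    ∃ (X : SchemeOver ℂ) (D : UnitaryBallUniformisationDatum 1 X), D.Hℂ = Jstar.map τ := by
  letI : Algebra L ℂ := τ.toAlgebra
  obtain ⟨gq, hgq, X, ιX, hcol, B, hB⟩ := S.pieces Kc
  exact ⟨X (Quotient.mk'' (CosetSpace.pt (rationalToFinAdelic _ L _ 2 Jstar) Kc.1.1 1)),
    B _, (hB (Quotient.mk'' (CosetSpace.pt (rationalToFinAdelic _ L _ 2 Jstar) Kc.1.1 1))).1⟩

/-- **Signature `(1,1)` at `τ`** ([Liu2021] §C.1 p. 107 `(p_τ, q_τ) = (n−1, 1)`, here `n = 2`): for a record `S` and any small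
level, `∃ T ∈ GL₂(ℂ)` with `Tᴴ · J⋆^τ · T = diag(1, −1)` — the piece datum's `signature_τ₁` read through `D.Hℂ = J⋆^τ`.
(The `∃ T` conjunct of the E-line's `SigDatum F ι₁ J⋆` at `t = 1`.)
[cite: Liu2021, App. C §C.1 p. 107; Rem. C.2 p. 108] [cite: BergeronMillsonMoeglin2016Balls, Part 2 §1.1] -/
theorem RecordSystemGS.exists_conjTranspose_mul_map_mul_eq_signatureMatrix_one (S : RecordSystemGS L Jstar τ K₀)
    (Kc : C5.SmallLevel K₀) :
    ∃ T : GL (Fin 2) ℂ, ((T : GL (Fin 2) ℂ) : Matrix (Fin 2) (Fin 2) ℂ)ᴴ * Jstar.map τ * (T : Matrix (Fin 2) (Fin 2) ℂ) =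
      signatureMatrix 1 := by
  obtain ⟨X, D, hH⟩ := S.exists_ballDatum_Hℂ_eq Kc
  obtain ⟨T, hT⟩ := D.signature_τ₁
  refine ⟨T, ?_⟩
  rw [← hH]
  exact hT

/-- **Off-place positivity, SIG-AUDIT case (2)** ([Liu2021] Rem. C.2 p. 108 «signature `(n, 0)` at other places»;
[RapoportSmithlingZhang2020Diagonal] §3.1 p. 8): for a record `S`, any small level, and a complex embedding `σ` of `L` with
`J⋆^σ ≠ J⋆^τ` and `J⋆^σ ≠ J⋆^τ̄` (`σ` differs from `τ` and from `τ̄` on `ℚ(J⋆ᵢⱼ)`), the matrix `J⋆^σ` is positive definite: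
the entries of `J⋆^τ = D.Hℂ` lie in the piece's CM field `E ⊆ ℂ`, `σ ∘ τ⁻¹` extends from `τ(ℚ(J⋆ᵢⱼ))` to `τ′ : E →+* ℂ`
(`IsAlgClosed.lift`), `τ′` is off the place of `E ⊆ ℂ` (`InfinitePlace.mk_eq_iff`), and `D.posDef_of_ne τ′` reads
`(D.H^{τ′}).PosDef = (J⋆^σ).PosDef`.
[cite: Liu2021, App. C §C.1 p. 107; Rem. C.2 p. 108] [cite: RapoportSmithlingZhang2020Diagonal, §3.1 p. 8]
[cite: BergeronMillsonMoeglin2016Balls, Part 2 §1.1] -/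
theorem RecordSystemGS.posDef_map_of_ne (S : RecordSystemGS L Jstar τ K₀) (Kc : C5.SmallLevel K₀) (σ : L →+* ℂ)
    (h₁ : Jstar.map σ ≠ Jstar.map τ) (h₂ : Jstar.map σ ≠ Jstar.map (ComplexEmbedding.conjugate τ)) :
    (Jstar.map σ).PosDef := by
  obtain ⟨X, D, hH⟩ := S.exists_ballDatum_Hℂ_eq Kc
  -- the entries of `J⋆^τ` are the entries of `D.H`, elements of `E`
  have hentry : ∀ i j, ((D.H i j : ↥D.E) : ℂ) = τ (Jstar i j) := fun i j => by
    have := congr_fun (congr_fun hH i) j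
    exact this
  -- `L₁ := ℚ(J⋆ᵢⱼ) ⊆ L` and `τ(L₁) ⊆ E`
  set L₁ : Subfield L := Subfield.closure (Set.range fun p : Fin 2 × Fin 2 => Jstar p.1 p.2) with hL₁
  have hL₁E : L₁ ≤ D.E.comap τ := by
    rw [hL₁, Subfield.closure_le]
    rintro _ ⟨⟨i, j⟩, rfl⟩
    rw [SetLike.mem_coe, Subfield.mem_comap, ← hentry i j]
    exact (D.H i j).2
  -- `e : L₁ →+* E`, `x ↦ τ x`
  let e : ↥L₁ →+* ↥D.E := (τ.comp L₁.subtype).codRestrict D.E fun x => hL₁E x.2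
  letI algE : Algebra ↥L₁ ↥D.E := e.toAlgebra
  letI algC : Algebra ↥L₁ ℂ := (σ.comp L₁.subtype).toAlgebra
  haveI : Module.IsTorsionFree ↥L₁ ↥D.E := DivisionSemiring.to_moduleIsTorsionFree
  haveI : Module.IsTorsionFree ↥L₁ ℂ := DivisionSemiring.to_moduleIsTorsionFree
  haveI : IsScalarTower ℚ ↥L₁ ↥D.E := IsScalarTower.of_algebraMap_eq' (Subsingleton.elim _ _)
  haveI : Algebra.IsAlgebraic ↥L₁ ↥D.E :=
    Algebra.IsAlgebraic.extendScalars (R := ℚ) (S := ↥L₁) (A := ↥D.E) (algebraMap ℚ ↥L₁).injective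
  -- extend `σ ∘ τ⁻¹` to `τ′ : E →+* ℂ`
  let ψ : ↥D.E →ₐ[↥L₁] ℂ := IsAlgClosed.lift
  let τ' : ↥D.E →+* ℂ := ψ.toRingHom
  have hτ'e : ∀ x : ↥L₁, τ' (e x) = σ (x : L) := fun x => ψ.commutes x
  -- the generators `J⋆ᵢⱼ ∈ L₁` and `e (J⋆ᵢⱼ) = D.Hᵢⱼ`
  have hmem : ∀ i j, Jstar i j ∈ L₁ := fun i j => Subfield.subset_closure ⟨(i, j), rfl⟩
  have heH : ∀ i j, e ⟨Jstar i j, hmem i j⟩ = D.H i j := fun i j =>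
    Subtype.ext (by rw [RingHom.codRestrict_apply, RingHom.comp_apply, Subfield.coe_subtype, hentry])
  have hτ'H : ∀ i j, τ' (D.H i j) = σ (Jstar i j) := fun i j => by
    rw [← heH, hτ'e]
  have hmapτ' : D.H.map τ' = Jstar.map σ := by
    ext i j
    simp only [Matrix.map_apply, hτ'H]
  -- `τ′` is off the place of the inclusion `E ⊆ ℂ`
  have hne : InfinitePlace.mk τ' ≠ InfinitePlace.mk D.E.subtype := by
    intro heq
    rcases InfinitePlace.mk_eq_iff.mp heq with h | h
    · apply h₁
      ext i j
      rw [Matrix.map_apply, Matrix.map_apply, ← hτ'H, h, ← hentry]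
      rfl
    · apply h₂
      ext i j
      have hconj : τ' = ComplexEmbedding.conjugate D.E.subtype := by
        rw [← h, ComplexEmbedding.involutive_conjugate]
      rw [Matrix.map_apply, Matrix.map_apply, ← hτ'H, hconj, ComplexEmbedding.conjugate_coe_eq,
        ComplexEmbedding.conjugate_coe_eq, ← hentry]
      rfl
  have hpos := D.posDef_of_ne τ' hne
  rwa [hmapτ'] at hpos

/-- **The `t = 1` signature datum of a record under case-(3) emptiness** (SIG-AUDIT (C): automatic for `ℚ(J⋆ᵢⱼ) ⊇ L⁺`):
if every complex embedding `σ` off the place of `τ` moves `J⋆` off `{J⋆^τ, J⋆^τ̄}`, then `J⋆^τ` has signature `(1,1)` and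
`J⋆^σ` is positive definite at every `σ` off the place of `τ` — the two signature conjuncts of the E-line's `SigDatum F ι₁ J⋆`
at `t = 1`, from `S.pieces` alone. [cite: Liu2021, App. C §C.1 p. 107; Rem. C.2 p. 108]
[cite: RapoportSmithlingZhang2020Diagonal, §3.1 p. 8] -/
theorem RecordSystemGS.signature_and_posDef_of_forall_ne (S : RecordSystemGS L Jstar τ K₀) (Kc : C5.SmallLevel K₀)
    (h : ∀ σ : L →+* ℂ, InfinitePlace.mk σ ≠ InfinitePlace.mk τ →
      Jstar.map σ ≠ Jstar.map τ ∧ Jstar.map σ ≠ Jstar.map (ComplexEmbedding.conjugate τ)) :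
    (∃ T : GL (Fin 2) ℂ, ((T : GL (Fin 2) ℂ) : Matrix (Fin 2) (Fin 2) ℂ)ᴴ * Jstar.map τ * (T : Matrix (Fin 2) (Fin 2) ℂ) =
        signatureMatrix 1) ∧
      ∀ σ : L →+* ℂ, InfinitePlace.mk σ ≠ InfinitePlace.mk τ → (Jstar.map σ).PosDef :=
  ⟨S.exists_conjTranspose_mul_map_mul_eq_signatureMatrix_one Kc,
    fun σ hσ => S.posDef_map_of_ne Kc σ (h σ hσ).1 (h σ hσ).2⟩

/-- **The E-line's `SigDatum` at `t = 1`, token-compatible** (`SigDatum F ι₁ J⋆` of `Cruxes/HLiu418/Lines/F0_P6a_PELWitnessE.lean`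
ED. 4 :377 unfolds to this conclusion with `F ↦ L`, `ι₁ ↦ τ`): under case-(3) emptiness a record yields the signature datum with
the trivial rescaling `t = 1` — so the closer of `stub_SIG` is `unfold SigDatum; exact S.exists_sigDatum_one_of_forall_ne Kc h`
once the residual NOREC socket supplies `h`. [cite: Liu2021, App. C §C.1 p. 107; Rem. C.2 p. 108]
[cite: RapoportSmithlingZhang2020Diagonal, §3.1 p. 8] -/
theorem RecordSystemGS.exists_sigDatum_one_of_forall_ne (S : RecordSystemGS L Jstar τ K₀) (Kc : C5.SmallLevel K₀)
    (h : ∀ σ : L →+* ℂ, InfinitePlace.mk σ ≠ InfinitePlace.mk τ →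
      Jstar.map σ ≠ Jstar.map τ ∧ Jstar.map σ ≠ Jstar.map (ComplexEmbedding.conjugate τ)) :
    ∃ t : L, 0 < (τ t).re ∧ (τ t).im = 0 ∧
      (∃ T : GL (Fin 2) ℂ, ((T : GL (Fin 2) ℂ) : Matrix (Fin 2) (Fin 2) ℂ)ᴴ * (t • Jstar).map τ * (T : Matrix (Fin 2) (Fin 2) ℂ) =
        signatureMatrix 1) ∧
      ∀ σ : L →+* ℂ, InfinitePlace.mk σ ≠ InfinitePlace.mk τ → ((t • Jstar).map σ).PosDef := by
  obtain ⟨hT, hpos⟩ := S.signature_and_posDef_of_forall_ne Kc h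
  refine ⟨1, ?_, ?_, ?_, ?_⟩
  · rw [map_one, Complex.one_re]
    exact one_pos
  · rw [map_one, Complex.one_im]
  · rw [one_smul]
    exact hT
  · intro σ hσ
    rw [one_smul]
    exact hpos σ hσ

end UnitaryCanonicalModel

end Literature.AlgebraicGeometry.ShimuraVarieties

end
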